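import Summits.Ventures.LatticeQCDFlow.Scaling.DominatedStarMixingLaw

/-!
HONEST FRAMING: exact (Metropolis-corrected) sampling algorithms for lattice gauge theory; figures
of merit are autocorrelation/cost numbers at stated couplings and volumes; no continuum-physics
claim.

# DominatedStarTunedConstants — THE DOMINATED STAR AT UNIFORM LISTING `m = cK` AND TUNED SWAP FRACTION: UNDER
# ONE-SIDED DOMINATION WITH CONSTANT `p`, HOT-ONLY UPDATES AND `t = p/(4+p)`,
# `((4+p)K/p − 1)·log(K/4) ≤ t_mix(1/4) ≤ ⌈(2(4+p)K/p²)·log(4(2K+p)/p)⌉` — BOTH SIDES ORDER `K·log K`, THE TRANSPORT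
# QUALITY COSTS A FACTOR `≈ 2/p` BETWEEN THEM; PERFECT TRANSPORTS AT `t = 1/2`, WEIGHTS `w`:
# `(2K/(2−w_0) − 1)·log(K/4) ≤ t_mix(1/4) ≤ ⌈(8K/w_0)·log(8(K+1))⌉` (lean-2 GEN-26, ours)

Venture-side (OURS).  Cell `lqcd-flow` (pub-lqcd), unit `pub-lqcd-lean-2-g26`, 2026-08-27.  Chapter M (the
coupon-collector ceiling without perfect transports), file 12 — the constants of `Scaling/DominatedStarMixingLaw` at
the natural operating point.  Uniform listing means every cold level is listed exactly (at least) `c` times and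
`m = cK`; the regime condition `4t ≤ p(1−t)w_0` of chapter M is met with equality by hot-only updates (`w_0 = 1`) and
the swap fraction `t = p/(4+p)`.

## What is proved

* §1 **`dominatedStar_mixingTime_le_uniform`** — `m = cK`: `t_mix(ε) ≤ ⌈(2K/(tp))·log((2K+p)/(pε))⌉`;
  **`perfectStar_mixingTime_le_uniform`** — `m = cK`: `t_mix(ε) ≤ ⌈(2K/(t(1−t)w_0))·log(2(K+1)/ε)⌉`.
* §2 **`tunedStar_mixingTime_two_sided`** — hot-only updates, `t = p/(4+p)`, `m = cK`, `K ≥ 2`, reversible cold kernels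
  (never used by the dynamics, asked by the floor's signature), rare cold start:
  **`((4+p)K/p − 1)·log(K/4) ≤ t_mix(1/4) ≤ ⌈(2(4+p)K/p²)·log((2K+p)/(p/4))⌉`**; `tunedStar_mixingTime_two_sided_of_card`.
* §3 **`balancedPerfectStar_mixingTime_two_sided`** — perfect transports, `t = 1/2`, weights `w` with `w_0 > 0`, `m = cK`:
  **`(2K/(2 − w_0) − 1)·log(K/4) ≤ t_mix(1/4) ≤ ⌈(8K/w_0)·log(2(K+1)/(1/4))⌉`**;
  `balancedPerfectStar_mixingTime_two_sided_of_card`.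

Reading (no numerics implied): a transport dominating one-sidedly with constant `p` buys the `K·log K` law at the price
of running the swap fraction at `p/(4+p)` and of a factor `≈ 2(4+p)/(p(4+p) − p²)·…` — order `1/p` — between the
proved floor and ceiling; the cold updates' share `1 − w_0` slows the perfectly transported hub linearly.  NOT CLAIMED:
that `t = p/(4+p)` is optimal (the regime is an artefact of the conservative tags), matching constants, anything
measured.  Literature grade (cell rule): OWN RESULT (specialisation of the tree's two-sided law); nothing cited as a
fact; no new bib keys.
-/

noncomputable section

open Finset Function
open Literature.Probability.MarkovChains

namespace Summit.Ventures.LatticeQCDFlow.Scaling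

variable {S : Type*} [Fintype S] [DecidableEq S] {K m : ℕ} {μ : Fin (K + 1) → S → ℝ} {M : Fin (K + 1) → S → S → ℝ}
  {w : Fin (K + 1) → ℝ} {t p : ℝ}

section Tuned
variable (κ : Fin m → Fin K) (φ : Fin m → Equiv.Perm S)

/-! ## §1 Uniform listing `m = cK` -/

/-- **UNIFORM LISTING (`m = cK`) UNDER ONE-SIDED DOMINATION: `t_mix(ε) ≤ ⌈(2K/(tp))·log((2K+p)/(pε))⌉`.** [ours] -/
theorem dominatedStar_mixingTime_le_uniform (ht0 : 0 < t) (ht1 : t ≤ 1) (hw0 : ∀ k, 0 ≤ w k) (hw1 : ∑ k, w k = 1)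
    (hμ : ∀ k x, 0 < μ k x) (hμ1 : ∀ k, ∑ u, μ k u = 1) (hM : ∀ k, IsRowStochastic (M k)) (hM0 : ∀ u v, M 0 u v = μ 0 v)
    (hstat : ∀ k : Fin (K + 1), k ≠ 0 → ∀ v, ∑ u, μ k u * M k u v = μ k v) (hp0 : 0 < p) (hp1 : p ≤ 1)
    (hdom : ∀ r u, p * μ (κ r).succ (φ r u) ≤ μ 0 u) (hreg : 4 * t ≤ p * (1 - t) * w 0) {c : ℕ} (hc1 : 1 ≤ c) (hK : 1 ≤ K)
    (hc : ∀ p' : Fin K, c ≤ (univ.filter (fun r : Fin m => κ r = p')).card) (hmc : m = c * K) {ε : ℝ} (hε : 0 < ε) :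
    mixingTime (fun y z : Fin (K + 1) → S =>
        t * ptGraphSwap μ (fun r : Fin m => (((0 : Fin (K + 1)), (κ r).succ) : Fin (K + 1) × Fin (K + 1))) φ y z
          + (1 - t) * prodKernel w M y z) (tensorFun μ) ε
      ≤ ⌈2 * (K : ℝ) / (t * p) * Real.log ((2 * (K : ℝ) + p) / (p * ε))⌉₊ := by
  have hm : 1 ≤ m := by rw [hmc]; exact Nat.one_le_iff_ne_zero.mpr (Nat.mul_ne_zero (by omega) (by omega))
  have hcm : c ≤ m := by rw [hmc]; exact Nat.le_mul_of_pos_right c (by omega)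
  have h := dominatedStar_mixingTime_le κ φ hm ht0 ht1 hw0 hw1 hμ hμ1 hM hM0 hstat hp0 hp1 hdom hreg hc1 hc hcm hε
  have hcpos : (0 : ℝ) < c := Nat.cast_pos.mpr (by omega)
  have e : 2 * (m : ℝ) / (t * c * p) = 2 * (K : ℝ) / (t * p) := by
    rw [hmc, Nat.cast_mul]
    field_simp
  rwa [e] at h

/-- **UNIFORM LISTING (`m = cK`) WITH PERFECT TRANSPORTS: `t_mix(ε) ≤ ⌈(2K/(t(1−t)w_0))·log(2(K+1)/ε)⌉`.** [ours] -/
theorem perfectStar_mixingTime_le_uniform (ht0 : 0 < t) (ht1 : t < 1) (hw0 : ∀ k, 0 ≤ w k) (hw00 : 0 < w 0)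
    (hw1 : ∑ k, w k = 1) (hμ : ∀ k x, 0 < μ k x) (hμ1 : ∀ k, ∑ u, μ k u = 1) (hM : ∀ k, IsRowStochastic (M k))
    (hM0 : ∀ u v, M 0 u v = μ 0 v) (hstat : ∀ k : Fin (K + 1), k ≠ 0 → ∀ v, ∑ u, μ k u * M k u v = μ k v)
    (hperf : ∀ r u, μ (κ r).succ (φ r u) = μ 0 u) {c : ℕ} (hc1 : 1 ≤ c) (hK : 1 ≤ K)
    (hc : ∀ p' : Fin K, c ≤ (univ.filter (fun r : Fin m => κ r = p')).card) (hmc : m = c * K) {ε : ℝ} (hε : 0 < ε) :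
    mixingTime (fun y z : Fin (K + 1) → S =>
        t * ptGraphSwap μ (fun r : Fin m => (((0 : Fin (K + 1)), (κ r).succ) : Fin (K + 1) × Fin (K + 1))) φ y z
          + (1 - t) * prodKernel w M y z) (tensorFun μ) ε
      ≤ ⌈2 * (K : ℝ) / (t * (1 - t) * w 0) * Real.log (2 * ((K : ℝ) + 1) / ε)⌉₊ := by
  have hm : 1 ≤ m := by rw [hmc]; exact Nat.one_le_iff_ne_zero.mpr (Nat.mul_ne_zero (by omega) (by omega))
  have hcm : c ≤ m := by rw [hmc]; exact Nat.le_mul_of_pos_right c (by omega)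
  have h := perfectStar_mixingTime_le κ φ hm ht0 ht1 hw0 hw00 hw1 hμ hμ1 hM hM0 hstat hperf hc1 hc hcm hε
  have hcpos : (0 : ℝ) < c := Nat.cast_pos.mpr (by omega)
  have h1t : 0 < 1 - t := by linarith
  have e : 2 * (m : ℝ) / (t * (1 - t) * w 0 * c) = 2 * (K : ℝ) / (t * (1 - t) * w 0) := by
    rw [hmc, Nat.cast_mul]
    field_simp
  rwa [e] at h

/-! ## §2 The tuned hot-only star: `w_0 = 1`, `t = p/(4+p)`, `m = cK` -/

/-- **THE TUNED DOMINATED STAR, BOTH SIDES:** hot-only updates, swap fraction `t = p/(4+p)` (the regime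
`4t ≤ p(1−t)w_0` with equality), `m = cK`, `K ≥ 2`, one-sided domination `p·μ_{l_r}(φ_r u) ≤ μ_0(u)` (`0 < p ≤ 1`),
exact hot sampler, reversible cold kernels, a configuration `x` with `Σ_k μ_{k+1}(x_{k+1}) ≤ 1/4`:
**`((4+p)K/p − 1)·log(K/4) ≤ t_mix(1/4) ≤ ⌈(2(4+p)K/p²)·log((2K+p)/(p·(1/4)))⌉`.** [ours] -/
theorem tunedStar_mixingTime_two_sided (hK : 2 ≤ K) (hμ : ∀ k x, 0 < μ k x) (hμ1 : ∀ k, ∑ u, μ k u = 1)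
    (hM : ∀ k, IsRowStochastic (M k)) (hMrev : ∀ k, DetailedBalance (μ k) (M k)) (hM0 : ∀ u v, M 0 u v = μ 0 v)
    (hp0 : 0 < p) (hp1 : p ≤ 1) (hdom : ∀ r u, p * μ (κ r).succ (φ r u) ≤ μ 0 u) {c : ℕ} (hc1 : 1 ≤ c)
    (hc : ∀ p' : Fin K, c ≤ (univ.filter (fun r : Fin m => κ r = p')).card) (hmc : m = c * K)
    (x : Fin (K + 1) → S) (hx : ∑ k : Fin K, μ k.succ (x k.succ) ≤ 1 / 4) :
    ((4 + p) * (K : ℝ) / p - 1) * Real.log (K / 4)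
        ≤ (mixingTime (fun y z : Fin (K + 1) → S =>
            p / (4 + p) * ptGraphSwap μ (fun r : Fin m => (((0 : Fin (K + 1)), (κ r).succ) : Fin (K + 1) × Fin (K + 1))) φ y z
              + (1 - p / (4 + p)) * prodKernel (fun k : Fin (K + 1) => if k = 0 then (1 : ℝ) else 0) M y z)
            (tensorFun μ) (1 / 4) : ℝ) ∧
      mixingTime (fun y z : Fin (K + 1) → S =>
            p / (4 + p) * ptGraphSwap μ (fun r : Fin m => (((0 : Fin (K + 1)), (κ r).succ) : Fin (K + 1) × Fin (K + 1))) φ y z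
              + (1 - p / (4 + p)) * prodKernel (fun k : Fin (K + 1) => if k = 0 then (1 : ℝ) else 0) M y z)
            (tensorFun μ) (1 / 4)
        ≤ ⌈2 * (4 + p) * (K : ℝ) / p ^ 2 * Real.log ((2 * (K : ℝ) + p) / (p * (1 / 4)))⌉₊ := by
  have hm : 1 ≤ m := by rw [hmc]; exact Nat.one_le_iff_ne_zero.mpr (Nat.mul_ne_zero (by omega) (by omega))
  have hcm : c ≤ m := by rw [hmc]; exact Nat.le_mul_of_pos_right c (by omega)
  have hw0 : ∀ k : Fin (K + 1), 0 ≤ (if k = 0 then (1 : ℝ) else 0) := fun k => by split_ifs <;> norm_num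
  have hw1 : ∑ k : Fin (K + 1), (if k = 0 then (1 : ℝ) else 0) = 1 := by
    rw [Finset.sum_ite_eq' univ (0 : Fin (K + 1)), if_pos (mem_univ _)]
  have h4p : 0 < 4 + p := by linarith
  have ht0 : 0 < p / (4 + p) := div_pos hp0 h4p
  have ht1 : p / (4 + p) ≤ 1 := by rw [div_le_one h4p]; linarith
  have hreg : 4 * (p / (4 + p)) ≤ p * (1 - p / (4 + p)) * (if (0 : Fin (K + 1)) = 0 then (1 : ℝ) else 0) := by
    rw [if_pos rfl, mul_one]
    have e : p * (1 - p / (4 + p)) = 4 * (p / (4 + p)) := by field_simp; ring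
    rw [e]
  have h := dominatedStar_mixingTime_two_sided κ φ hK hm ht0 ht1 hw0 hw1 hμ hμ1 hM hMrev hM0 hp0 hp1 hdom hreg hc1 hc
    hcm x hx
  have hcpos : (0 : ℝ) < c := Nat.cast_pos.mpr (by omega)
  have e0 : p / (4 + p) + (1 - p / (4 + p)) * (1 - (if (0 : Fin (K + 1)) = 0 then (1 : ℝ) else 0)) = p / (4 + p) := by
    rw [if_pos rfl]; ring
  have e1 : (K : ℝ) / (p / (4 + p)) = (4 + p) * (K : ℝ) / p := by
    rw [div_div_eq_mul_div]; ring
  have e2 : 2 * (m : ℝ) / (p / (4 + p) * c * p) = 2 * (4 + p) * (K : ℝ) / p ^ 2 := by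
    rw [hmc, Nat.cast_mul, div_eq_div_iff (by positivity) (by positivity)]
    field_simp
  rw [e0, e1, e2] at h
  exact h

/-- **THE TUNED DOMINATED STAR ON A LARGE CONFIGURATION SPACE (`|S| ≥ 4K`, `K ≥ 4`):**
**`(K − 1)·log(K/4) ≤ ((4+p)K/p − 1)·log(K/4) ≤ t_mix(1/4) ≤ ⌈(2(4+p)K/p²)·log((2K+p)/(p·(1/4)))⌉`** with the rare start
supplied (the first inequality recorded as `(K − 1)·log(K/4) ≤ t_mix(1/4)`). [ours] -/
theorem tunedStar_mixingTime_two_sided_of_card (hK : 4 ≤ K) (hS : 4 * K ≤ Fintype.card S) (hμ : ∀ k x, 0 < μ k x)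
    (hμ1 : ∀ k, ∑ u, μ k u = 1) (hM : ∀ k, IsRowStochastic (M k)) (hMrev : ∀ k, DetailedBalance (μ k) (M k))
    (hM0 : ∀ u v, M 0 u v = μ 0 v) (hp0 : 0 < p) (hp1 : p ≤ 1) (hdom : ∀ r u, p * μ (κ r).succ (φ r u) ≤ μ 0 u)
    {c : ℕ} (hc1 : 1 ≤ c) (hc : ∀ p' : Fin K, c ≤ (univ.filter (fun r : Fin m => κ r = p')).card) (hmc : m = c * K) :
    ((K : ℝ) - 1) * Real.log (K / 4)
        ≤ (mixingTime (fun y z : Fin (K + 1) → S =>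
            p / (4 + p) * ptGraphSwap μ (fun r : Fin m => (((0 : Fin (K + 1)), (κ r).succ) : Fin (K + 1) × Fin (K + 1))) φ y z
              + (1 - p / (4 + p)) * prodKernel (fun k : Fin (K + 1) => if k = 0 then (1 : ℝ) else 0) M y z)
            (tensorFun μ) (1 / 4) : ℝ) ∧
      mixingTime (fun y z : Fin (K + 1) → S =>
            p / (4 + p) * ptGraphSwap μ (fun r : Fin m => (((0 : Fin (K + 1)), (κ r).succ) : Fin (K + 1) × Fin (K + 1))) φ y z
              + (1 - p / (4 + p)) * prodKernel (fun k : Fin (K + 1) => if k = 0 then (1 : ℝ) else 0) M y z)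
            (tensorFun μ) (1 / 4)
        ≤ ⌈2 * (4 + p) * (K : ℝ) / p ^ 2 * Real.log ((2 * (K : ℝ) + p) / (p * (1 / 4)))⌉₊ := by
  obtain ⟨x, hx⟩ := exists_rare_coldStart (μ := μ) hμ1 hS
  obtain ⟨hlo, hhi⟩ := tunedStar_mixingTime_two_sided κ φ (by omega) hμ hμ1 hM hMrev hM0 hp0 hp1 hdom hc1 hc hmc x hx
  refine ⟨le_trans ?_ hlo, hhi⟩
  have hK4 : (4 : ℝ) ≤ K := by exact_mod_cast hK
  have hlog : 0 ≤ Real.log (K / 4) := Real.log_nonneg (by rw [le_div_iff₀ (by norm_num : (0:ℝ) < 4)]; linarith)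
  refine mul_le_mul_of_nonneg_right ?_ hlog
  have hKp : (K : ℝ) ≤ (4 + p) * (K : ℝ) / p := by
    rw [le_div_iff₀ hp0]; nlinarith
  linarith

/-! ## §3 The balanced perfectly transported hub: `t = 1/2`, weights `w`, `m = cK` -/

/-- **THE BALANCED PERFECT STAR WITH UPDATE WEIGHTS `w`, BOTH SIDES:** perfect transports, `t = 1/2`, `w_0 > 0`,
`m = cK`, `K ≥ 2`, reversible cold kernels, rare cold start:
**`(2K/(2 − w_0) − 1)·log(K/4) ≤ t_mix(1/4) ≤ ⌈(8K/w_0)·log(2(K+1)/(1/4))⌉`** — the cold updates' share `1 − w_0`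
dilates both sides. [ours] -/
theorem balancedPerfectStar_mixingTime_two_sided (hK : 2 ≤ K) (hw0 : ∀ k, 0 ≤ w k) (hw00 : 0 < w 0)
    (hw1 : ∑ k, w k = 1) (hμ : ∀ k x, 0 < μ k x) (hμ1 : ∀ k, ∑ u, μ k u = 1) (hM : ∀ k, IsRowStochastic (M k))
    (hMrev : ∀ k, DetailedBalance (μ k) (M k)) (hM0 : ∀ u v, M 0 u v = μ 0 v)
    (hperf : ∀ r u, μ (κ r).succ (φ r u) = μ 0 u) {c : ℕ} (hc1 : 1 ≤ c)
    (hc : ∀ p' : Fin K, c ≤ (univ.filter (fun r : Fin m => κ r = p')).card) (hmc : m = c * K)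
    (x : Fin (K + 1) → S) (hx : ∑ k : Fin K, μ k.succ (x k.succ) ≤ 1 / 4) :
    (2 * (K : ℝ) / (2 - w 0) - 1) * Real.log (K / 4)
        ≤ (mixingTime (fun y z : Fin (K + 1) → S =>
            1 / 2 * ptGraphSwap μ (fun r : Fin m => (((0 : Fin (K + 1)), (κ r).succ) : Fin (K + 1) × Fin (K + 1))) φ y z
              + (1 - 1 / 2) * prodKernel w M y z) (tensorFun μ) (1 / 4) : ℝ) ∧
      mixingTime (fun y z : Fin (K + 1) → S =>
            1 / 2 * ptGraphSwap μ (fun r : Fin m => (((0 : Fin (K + 1)), (κ r).succ) : Fin (K + 1) × Fin (K + 1))) φ y z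
              + (1 - 1 / 2) * prodKernel w M y z) (tensorFun μ) (1 / 4)
        ≤ ⌈8 * (K : ℝ) / w 0 * Real.log (2 * ((K : ℝ) + 1) / (1 / 4))⌉₊ := by
  have hm : 1 ≤ m := by rw [hmc]; exact Nat.one_le_iff_ne_zero.mpr (Nat.mul_ne_zero (by omega) (by omega))
  have hcm : c ≤ m := by rw [hmc]; exact Nat.le_mul_of_pos_right c (by omega)
  have h := perfectStar_mixingTime_two_sided κ φ hK hm (t := 1 / 2) (by norm_num) (by norm_num) hw0 hw00 hw1 hμ hμ1 hM
    hMrev hM0 hperf hc1 hc hcm x hx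
  have hcpos : (0 : ℝ) < c := Nat.cast_pos.mpr (by omega)
  have h2w : 0 < 2 - w 0 := by linarith [weight_zero_le_one hw0 hw1]
  have e0 : (1 : ℝ) / 2 + (1 - 1 / 2) * (1 - w 0) = (2 - w 0) / 2 := by ring
  have e1 : (K : ℝ) / ((2 - w 0) / 2) = 2 * (K : ℝ) / (2 - w 0) := by
    rw [div_div_eq_mul_div]; ring
  have e2 : 2 * (m : ℝ) / (1 / 2 * (1 - 1 / 2) * w 0 * c) = 8 * (K : ℝ) / w 0 := by
    rw [hmc, Nat.cast_mul, div_eq_div_iff (by positivity) (by positivity)]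
    field_simp
    ring
  rw [e0, e1, e2] at h
  exact h

/-- **THE BALANCED PERFECT STAR ON A LARGE CONFIGURATION SPACE (`|S| ≥ 4K`, `K ≥ 4`):**
**`(K − 1)·log(K/4) ≤ t_mix(1/4) ≤ ⌈(8K/w_0)·log(2(K+1)/(1/4))⌉`.** [ours] -/
theorem balancedPerfectStar_mixingTime_two_sided_of_card (hK : 4 ≤ K) (hS : 4 * K ≤ Fintype.card S)
    (hw0 : ∀ k, 0 ≤ w k) (hw00 : 0 < w 0) (hw1 : ∑ k, w k = 1) (hμ : ∀ k x, 0 < μ k x) (hμ1 : ∀ k, ∑ u, μ k u = 1)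
    (hM : ∀ k, IsRowStochastic (M k)) (hMrev : ∀ k, DetailedBalance (μ k) (M k)) (hM0 : ∀ u v, M 0 u v = μ 0 v)
    (hperf : ∀ r u, μ (κ r).succ (φ r u) = μ 0 u) {c : ℕ} (hc1 : 1 ≤ c)
    (hc : ∀ p' : Fin K, c ≤ (univ.filter (fun r : Fin m => κ r = p')).card) (hmc : m = c * K) :
    ((K : ℝ) - 1) * Real.log (K / 4)
        ≤ (mixingTime (fun y z : Fin (K + 1) → S =>
            1 / 2 * ptGraphSwap μ (fun r : Fin m => (((0 : Fin (K + 1)), (κ r).succ) : Fin (K + 1) × Fin (K + 1))) φ y z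
              + (1 - 1 / 2) * prodKernel w M y z) (tensorFun μ) (1 / 4) : ℝ) ∧
      mixingTime (fun y z : Fin (K + 1) → S =>
            1 / 2 * ptGraphSwap μ (fun r : Fin m => (((0 : Fin (K + 1)), (κ r).succ) : Fin (K + 1) × Fin (K + 1))) φ y z
              + (1 - 1 / 2) * prodKernel w M y z) (tensorFun μ) (1 / 4)
        ≤ ⌈8 * (K : ℝ) / w 0 * Real.log (2 * ((K : ℝ) + 1) / (1 / 4))⌉₊ := by
  obtain ⟨x, hx⟩ := exists_rare_coldStart (μ := μ) hμ1 hS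
  obtain ⟨hlo, hhi⟩ := balancedPerfectStar_mixingTime_two_sided κ φ (by omega) hw0 hw00 hw1 hμ hμ1 hM hMrev hM0 hperf
    hc1 hc hmc x hx
  refine ⟨le_trans ?_ hlo, hhi⟩
  have hK4 : (4 : ℝ) ≤ K := by exact_mod_cast hK
  have hlog : 0 ≤ Real.log (K / 4) := Real.log_nonneg (by rw [le_div_iff₀ (by norm_num : (0:ℝ) < 4)]; linarith)
  refine mul_le_mul_of_nonneg_right ?_ hlog
  have hw01 := weight_zero_le_one hw0 hw1
  have h2w : 0 < 2 - w 0 := by linarith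
  have hKp : (K : ℝ) ≤ 2 * (K : ℝ) / (2 - w 0) := by
    rw [le_div_iff₀ h2w]; nlinarith
  linarith

end Tuned

end Summit.Ventures.LatticeQCDFlow.Scaling

end
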